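import Summits.BirchSwinnertonDyer.Rank1Residual.Additive.PotSupersingularClasses
import Summits.BirchSwinnertonDyer.Rank1Residual.Additive.SubGordThree
import Literature.NumberTheory.EllipticCurves.CyclotomicIwasawaMainTheoremIrreducibleBaseChangeProofs
import HarnessLib

/-!
# O5a at `p = 3`: the census dictionary `(G) ∧ ss ⟺ SubGord ∧ GoodSS(E^{(−3)})` and the typed split
# O5a₀ (`a₃(E^{(−3)}) = 0`, Kobayashi-type) ⊔ O5a± (`a₃(E^{(−3)}) = ±3`, Sprung-type)
# (cell `b2b-bsdres`, lane CLASS-CLOSURE, seat cc-typer-5; E2 sub-partition predicates BY NAME — nothing asserted)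

HONEST FRAMING (cell `b2b-bsdres`, run/shared/lean/b2b/bsd-rank1-residual/, verbatim in every
file): the goal of the cell is to DELETE the COMBINATION-SHAPED residual classes of the
Birch–Swinnerton-Dyer formula for ALL analytic-rank `≤ 1` elliptic curves over `ℚ` — "full BSD
formula for every rank `≤ 1` curve in class `C`" assembled STRICTLY from published theorems — so
that the rank-`≤ 1` remainder becomes exactly the CONSTRUCTION-SHAPED classes, which are TYPED
(missing-input `Prop`s), NOT attempted. This is not "finishing BSD". Lane CLASS-CLOSURE
(`CLASS-CLOSURE-PLAN.md` §3.5 O5, E2 "E-over-K_e" predicates of OWNERS §2 row cc-typer-5): research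
routes; no claim beyond the stated classes; census output is EVIDENCE, never a Literature fact; no
fact, no conjecture is introduced here (two census-decidable predicates with bodies + theorems over
EXISTING tree theorems); nothing is booked; no mark of `RESIDUAL-MAP.md` moves.

## What is typed

The O5a cell `Additive.SubGss W p` (`(G) ∧ ss`, `PotSupersingularClasses.lean`: `SubGord ∧ ¬TypeGOrd`)
at `p = 3` splits by the Frobenius trace of the good supersingular twist `V = E ⊗ χ₋₃` (`p* = −3`):
`a₃(V) ∈ {0, ±3}` (Hasse: `|a₃| ≤ 2√3`, and `3 ∣ a₃` at a supersingular prime). The two halves have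
DIFFERENT signed theories in print for `V` — Kobayashi 2003 (`a_p = 0`, `±`) versus Sprung 2012
(`a_p ≠ 0`, `♯/♭`) — and different kernel coverage today (additive-p4's V18
`ClassX4.bsdp_three_of_ssTwist_of_shaAn_units` is `a₃(V) = 0` only; o5-r1's T1a
`O5.KobayashiOmegaBranchLowerDivisibilityThree` is `a₃(V) = 0`). Typed here:

* `subGss_three_iff_subGord_and_goodSS_twist` — THE CENSUS RULE: for `E` additive at `3` and ANY
  globally minimal model `V` of `E^{(−3)}`, `SubGss W 3 ↔ SubGord W 3 ∧ GoodSS V 3` (tree predicates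
  `SubGord`, `GoodSS = good ∧ 3 ∣ a₃`), from gen 7/8's twist dictionary at `3`
  (`typeG_three_iff_good_twist`, `typeGOrd_three_iff_goodOrd_twist`, `TypeGThree.lean`);
* `SubGssZeroThree W` (O5a₀) / `SubGssUnitThree W` (O5a±): `SubGss W 3` ∧ SOME globally minimal
  model of `E^{(−3)}` has `a₃ = 0` / `a₃ ≠ 0`; `subGss_three_iff_zero_or_unit` (exhaustive, by the
  existence of a globally minimal model of the twist, Silverman VIII.8.3 = tree theorem
  `exists_isGloballyMinimal_smul_eq_quadraticTwist`). Disjointness is the model-independence of `a₃`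
  among globally minimal models (isomorphic minimal models have the same reduction) — not restated
  here; the census reads `a₃` off the Cremona model of the twist.

CENSUS (EVIDENCE, never a fact): o5-r1's C-A3 pilot (kit j120899, `HOME/b2b-bsdres-o5-r1/census/ca3_*`):
on 38 sample O5 curves `ã_P` over `ℚ(∜3)` is `0` on every O5b and O5a₀ row and `±3` exactly on the
O5a± rows; additive-p4 V18 window (N < 2·10⁴, rank (0,0) CORE rows): 18 rows `a₃(V) = 0`, 41 rows
`a₃(V) = ±3`; S-b: `(G) ∧ ss` at `3` = 9 744 X4 pairs (gen 0 census-typer5), O5a cells of record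
3 422 (obsanat 05:57Z, all p). The `a₃(V) = ±3` half (Sprung ♯/♭ on the `ω`-branch over `ℚ(μ_{3^∞})`)
has NO object in print (gen 0 `O5/TYPED.md` §4) — named for ideation.

References: S. Kobayashi, Invent. Math. 152 (2003) [Kobayashi2003]; F. Sprung, J. Number Theory 132
(2012) [Sprung2012]; D. Delbourgo, Compositio 113 (1998) §1.5 [Delbourgo1998]; J. H. Silverman, AEC
VIII.8 Cor. 8.3 [SilvermanAEC2009]; HOME/class-closure/O5/TYPED.md §1/§4/§6.
-/

noncomputable section

open scoped Classical

open WeierstrassCurve Literature.NumberTheory.EllipticCurves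
  Literature.NumberTheory.EllipticCurves.Rank1Residual
  Summit.BirchSwinnertonDyer.Rank1Residual.Additive

namespace Summit.BirchSwinnertonDyer.Rank1Residual.O5

section Dictionary

variable (W : WeierstrassCurve ℚ) [W.IsElliptic] [W.IsGloballyMinimal]

/-- `p* = −3` at `p = 3`: the tree's twist parameter `(−1)^{(p−1)/2}·p` (written `(−1)^{p/2}·p` with
natural-number division in `TypeGThree.lean`) is `−3`. [folklore] -/
theorem pstar_three : ((-1 : ℚ) ^ ((3 : ℕ) / 2) * (3 : ℕ) : ℚ) = -3 := by
  have h : (3 : ℕ) / 2 = 1 := rfl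
  rw [h, pow_one]; norm_num

/-- **The census rule for O5a at `3`.** For `E` additive at `3` and any globally minimal model `V` of
the quadratic twist `E^{(−3)}` (`C • W.quadraticTwist (−3) = V`):
`SubGss W 3 ↔ SubGord W 3 ∧ GoodSS V 3` — "(G) and the twist by `χ₋₃` is good SUPERSINGULAR at `3`"
(`GoodSS V 3 = good ∧ 3 ∣ a₃(V)`). From the `p = 3` twist dictionary `TypeG W 3 ↔ V good at 3`,
`TypeGOrd W 3 ↔ GoodOrd V 3` (gen 7, `TypeGThree.lean`) and `SubGord W 3 ↔ TypeG W 3` (gen 8).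
[cite: Delbourgo1998, §1.5 (G)] -/
theorem subGss_three_iff_subGord_and_goodSS_twist (hadd : Addv W 3) (V : WeierstrassCurve ℚ)
    [V.IsElliptic] [V.IsGloballyMinimal] (C : VariableChange ℚ)
    (hV : C • W.quadraticTwist (-3) = V) : SubGss W 3 ↔ SubGord W 3 ∧ GoodSS V 3 := by
  have hV' : C • W.quadraticTwist ((-1 : ℚ) ^ ((3 : ℕ) / 2) * (3 : ℕ)) = V := by
    rw [pstar_three]; exact hV
  have hG := typeG_three_iff_good_twist W hadd V C hV'
  have hGO := typeGOrd_three_iff_goodOrd_twist W hadd V C hV'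
  constructor
  · intro h
    have hgood : V.HasGoodReductionAtPrime 3 := hG.mp (SubGss.typeG W 3 (by decide) hadd h)
    refine ⟨h.1, hgood, ?_⟩
    by_contra hndvd
    exact h.2 (hGO.mpr ⟨hgood, hndvd⟩)
  · rintro ⟨hS, hgood, hdvd⟩
    exact ⟨hS, fun hO ↦ (hGO.mp hO).2 hdvd⟩

end Dictionary

/-! ## The split O5a = O5a₀ ⊔ O5a± at `p = 3` (census-decidable predicates; nothing asserted) -/

section Split

variable (W : WeierstrassCurve ℚ) [W.IsElliptic] [W.IsGloballyMinimal]

/-- **O5a₀ — `(G) ∧ ss` at `3` of KOBAYASHI type**: `SubGss W 3` and some globally minimal model `V`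
of the twist `E^{(−3)}` (then good supersingular at `3`, `subGss_three_iff_subGord_and_goodSS_twist`)
has `a₃(V) = 0`. The locus of o5-r1's T1a `O5.KobayashiOmegaBranchLowerDivisibilityThree` and of
additive-p4's V18 (`ClassX4.bsdp_three_of_ssTwist_of_shaAn_units`). Census: `a₃` of the Cremona twist
(additive-p4 V18 window: 18 CORE rows). A predicate; nothing asserted. [cite: Kobayashi2003, Thm. 1.3 (a_p = 0)] -/
def SubGssZeroThree : Prop :=
  SubGss W 3 ∧ ∃ (V : WeierstrassCurve ℚ) (_ : V.IsElliptic) (_ : V.IsGloballyMinimal)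
    (C : VariableChange ℚ), C • W.quadraticTwist (-3) = V ∧ V.frobeniusTrace 3 = 0

/-- **O5a± — `(G) ∧ ss` at `3` of SPRUNG type**: `SubGss W 3` and some globally minimal model `V` of
`E^{(−3)}` has `a₃(V) ≠ 0` (then `a₃(V) = ±3`: `3 ∣ a₃` by `GoodSS`, `|a₃| ≤ 2√3` by Hasse). No signed
object in print on the `ω`-branch for these rows (Sprung's ♯/♭ theory is over `ℚ_∞`): the irreducible
part of O5a, named for ideation (`O5/TYPED.md` §4). Census: additive-p4 V18 window 41 CORE rows;
o5-r1 C-A3: `ã_P = ±3` over `ℚ(∜3)` exactly here. A predicate; nothing asserted.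
[cite: Sprung2012, Thm. 7.16 and Conj. 7.21 (pp. 1504–1505)] -/
def SubGssUnitThree : Prop :=
  SubGss W 3 ∧ ∃ (V : WeierstrassCurve ℚ) (_ : V.IsElliptic) (_ : V.IsGloballyMinimal)
    (C : VariableChange ℚ), C • W.quadraticTwist (-3) = V ∧ V.frobeniusTrace 3 ≠ 0

/-- **O5a = O5a₀ ∪ O5a± at `3`** (no pair lost): a globally minimal model of the twist exists
(Silverman VIII.8.3, tree theorem `exists_isGloballyMinimal_smul_eq_quadraticTwist`) and its `a₃` is
`0` or not. [cite: SilvermanAEC2009, VIII.8 Cor. 8.3] -/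
theorem subGss_three_iff_zero_or_unit : SubGss W 3 ↔ SubGssZeroThree W ∨ SubGssUnitThree W := by
  constructor
  · intro h
    obtain ⟨V, hVE, hVM, C, hC⟩ :=
      exists_isGloballyMinimal_smul_eq_quadraticTwist W (d := (-3 : ℚ)) (by norm_num)
    have hV : C⁻¹ • W.quadraticTwist (-3) = V := by rw [← hC, inv_smul_smul]
    by_cases ha : V.frobeniusTrace 3 = 0
    · exact Or.inl ⟨h, V, hVE, hVM, C⁻¹, hV, ha⟩
    · exact Or.inr ⟨h, V, hVE, hVM, C⁻¹, hV, ha⟩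
  · rintro (h | h)
    · exact h.1
    · exact h.1

/-- Both halves lie in O5 (`ClassO5 W 3 = 3 ≠ 2 ∧ Addv ∧ (SubGss ∨ SubTprime)`), given additivity.
[folklore] -/
theorem classO5_three_of_subGssZero_or_unit (hadd : Addv W 3)
    (h : SubGssZeroThree W ∨ SubGssUnitThree W) : ClassO5 W 3 :=
  ⟨by decide, hadd, Or.inl ((subGss_three_iff_zero_or_unit W).mpr h)⟩

/-- **On O5a₀ the witnessing twist is good supersingular with `a₃ = 0`** — exactly the hypothesis
shape `V.HasGoodReductionAtPrime 3 ∧ V.frobeniusTrace 3 = 0` of T1a / V18's consumers.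
[cite: Kobayashi2003, Thm. 1.3 (a_p = 0)] -/
theorem SubGssZeroThree.exists_good_twist_frobeniusTrace_eq_zero (hadd : Addv W 3)
    (h : SubGssZeroThree W) :
    ∃ (V : WeierstrassCurve ℚ) (_ : V.IsElliptic) (_ : V.IsGloballyMinimal) (C : VariableChange ℚ),
      C • W.quadraticTwist (-3) = V ∧ V.HasGoodReductionAtPrime 3 ∧ V.frobeniusTrace 3 = 0 := by
  obtain ⟨hS, V, hVE, hVM, C, hV, ha⟩ := h
  have hgood := ((subGss_three_iff_subGord_and_goodSS_twist W hadd V C hV).mp hS).2.1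
  exact ⟨V, hVE, hVM, C, hV, hgood, ha⟩

/-- **On O5a± the witnessing twist is good supersingular with `3 ∣ a₃ ≠ 0`** (so `a₃ = ±3` by the
Hasse bound — not restated). [cite: Sprung2012, Thm. 7.16 (pp. 1504–1505)] -/
theorem SubGssUnitThree.exists_good_twist_three_dvd_frobeniusTrace_ne_zero (hadd : Addv W 3)
    (h : SubGssUnitThree W) :
    ∃ (V : WeierstrassCurve ℚ) (_ : V.IsElliptic) (_ : V.IsGloballyMinimal) (C : VariableChange ℚ),
      C • W.quadraticTwist (-3) = V ∧ V.HasGoodReductionAtPrime 3 ∧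
        (3 : ℤ) ∣ V.frobeniusTrace 3 ∧ V.frobeniusTrace 3 ≠ 0 := by
  obtain ⟨hS, V, hVE, hVM, C, hV, ha⟩ := h
  have hss := ((subGss_three_iff_subGord_and_goodSS_twist W hadd V C hV).mp hS).2
  exact ⟨V, hVE, hVM, C, hV, hss.1, hss.2, ha⟩

end Split

end Summit.BirchSwinnertonDyer.Rank1Residual.O5

end
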